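import Literature.NumberTheory.PAdicHodge.BmaxPlusPhiRoadPeriodHoms
import HarnessLib

/-!
# The φ-road's integrating pair: `Pω(κ_u σ) = σ b_ω − b_ω` and `Pη(κ_u σ) = σ b_η − b_η` for the Kummer cocycle of a division sequence

Topic `Literature/NumberTheory/PAdicHodge`; namespace `Literature.NumberTheory.PAdicHodge.AinfTop`. THEOREMS ONLY (no definition, no named
fact, no instance, no `sorry`). Sequel of `BmaxPlusPhiRoadPeriodHoms` (honest `Pω = bmaxPlusToBdR ∘ Lh`, `Pη = bmaxPlusToBdR ∘ φ ∘ Lh` on `T_pŴ`). For a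
`[p]_W`-division sequence `u` of a point `P = u₀ ∈ Ŵ(𝔪_F)` fixed by `Γ_F`, deep enough (`‖u₀‖^N ≤ ‖p‖`), with `A_max`-period `Λ_u = Λ_N(ι[ũ], z)`, the Kummer
cocycle `κ_u(σ) ∈ T_pŴ` (`kummerCocycle`, `[κ_u(σ)~] = σ[ũ] − [ũ]`) has periods

* ★★ `logSum_torsionLiftHom_kummerCocycle` — **`L_{κ_u σ} = σ(Λ_u) − Λ_u` in `A_max`** (additivity `logSum_val_add` at index `N` for the points `[κ_u σ~]` and
  `[ũ]`, whose sum is `σ[ũ] = [σu~]` (`torsionLiftHom_kummerCocycle`, `galPtN_divisionLiftPt`), and `Λ([σu~]) = σΛ([ũ])`, `galBmaxPlus_logSum_divisionLiftPt`);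
* ★★ `phiRoad_integrating_pair` — for the honest maps of `exists_phiRoad_periodHoms` (through `hLh`, `hPω`, `hPη`) and
  `b_ω := bmaxPlusToBdR Λ_u`, `b_η := bmaxPlusToBdR (φΛ_u)`: **`Pω(κ_u σ) = σ·b_ω − b_ω` and `Pη(κ_u σ) = σ·b_η − b_η`** in `B_dR⁺` — the hypotheses
  `hbω`, `hbη` («integrating pair») of the socket's capstone for the φ-road (`bmaxPlusToBdR` is `Γ_F`-equivariant, `φσ = σφ`).

B8b of the φ-road of line `kato_lever` (crux K★ `stmt-BirchSwinnertonDyer-22226`, memo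
`Summits/…/Cruxes/StarredOptimalManinUnitFiveSeven/Lines/kato-lever-K2-tower-instantiation.md` §6 (ii)). Infrastructure only; BSD / K★ are not proved by
any of this.

## References
* S. Bloch, K. Kato, *L-functions and Tamagawa numbers of motives* (1990), Ex. 3.10.1. [BlochKato1990]
* K. Kato, LNM 1553 (1993), Ch. II Lemma 1.4.3. [Kato1993LNM1553]
* J.-M. Fontaine, *Le corps des périodes p-adiques*, Astérisque 223 (1994), Exp. II §1.2.2, §1.5. [FontaineAsterisque223III]
-/

noncomputable section

open Ideal WittVector ValuativeRel Field

namespace Literature.NumberTheory.PAdicHodge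

namespace AinfTop

open Literature.NumberTheory.GaloisRepresentations Literature.NumberTheory.GaloisRepresentations.IsNonarchimedeanLocalField
open Literature.NumberTheory.GaloisRepresentations.LubinTate Literature.NumberTheory.EllipticCurves
open Literature.RingTheory.FormalGroups Literature.AlgebraicGeometry.Resolution GaloisContinuity

variable {F : Type} [Field F] [ValuativeRel F] [TopologicalSpace F] [IsNonarchimedeanLocalField F]
  [CharZero F] {p : ℕ} [Fact p.Prime] [Fact (¬ IsUnit (p : integerC F))]
  [IsAdicComplete (Ideal.span {(p : integerC F)}) (integerC F)]
  {hθ : Function.Surjective (fontaineTheta (integerC F) p)} (W : WeierstrassCurve ℤ)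
  {u : ℕ → (maxNilIdealC F).toIdeal} (hup : ∀ n, mulPC F p W (u (n + 1)) = u n)
  (hu₀ : ∀ σ : absoluteGaloisGroup F, galCBall σ (u 0 : CBall F) = u 0)

/-- `σ z` is a witness for `ι[σu~]` when `z` is one for `ι[ũ]`. [cite: FontaineAsterisque223III, Exp. II §1.2] -/
theorem algebraMap_divisionLiftPt_galSeq_pow_eq (σ : absoluteGaloisGroup F) {N : ℕ} {z : bmaxZero F p}
    (hz : algebraMap (Ainf (p := p) F) (bmaxZero F p)
        ((of F p).symm (((divisionLiftPt W hθ u hup).val : (nilTheta F p hθ).toIdeal) : AinfTop F p)) ^ N = (p : bmaxZero F p) * z) :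
    algebraMap (Ainf (p := p) F) (bmaxZero F p)
        ((of F p).symm (((divisionLiftPt W hθ (galSeq F σ u) (mulPC_galSeq W hθ σ hup)).val : (nilTheta F p hθ).toIdeal) : AinfTop F p)) ^ N =
      (p : bmaxZero F p) * galBmaxZero σ z := by
  have h2 := congrArg (galBmaxZero σ) hz
  rw [map_pow, map_mul, map_natCast] at h2
  rw [← galPtN_divisionLiftPt, coe_val_galPtN, galBmaxPlus_logSum_torsionLiftHom.gal_of_symm]
  exact h2

set_option maxHeartbeats 3200000 in
/-- ★★ **`L_{κ_u σ} = σ(Λ_u) − Λ_u` in `A_max`.** For a `[p]_W`-division sequence `u` with `Γ_F`-fixed base point and `‖u₀‖^N ≤ ‖p‖` (`N ≥ 1`), its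
`A_max`-period `Λ_u = Λ_N(ι[ũ], z)`, and the Kummer cocycle `κ_u(σ) ∈ T_pŴ`: for any witness `z_κ` of `ι[κ_u σ~]`,
`Λ_N(ι[κ_u σ~], z_κ) = σ(Λ_u) − Λ_u`. [cite: BlochKato1990, Ex. 3.10.1] [cite: FontaineAsterisque223III, Exp. II §1.2.2] -/
theorem logSum_torsionLiftHom_kummerCocycle {N : ℕ} (hN : 1 ≤ N)
    (huN : ‖(((u 0 : (maxNilIdealC F).toIdeal) : CBall F) : CompletedAlgClosure F)‖ ^ N ≤ ‖(p : CompletedAlgClosure F)‖)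
    {z : bmaxZero F p}
    (hz : algebraMap (Ainf (p := p) F) (bmaxZero F p)
        ((of F p).symm (((divisionLiftPt W hθ u hup).val : (nilTheta F p hθ).toIdeal) : AinfTop F p)) ^ N = (p : bmaxZero F p) * z)
    (σ : absoluteGaloisGroup F) {zκ : bmaxZero F p}
    (hzκ : algebraMap (Ainf (p := p) F) (bmaxZero F p)
        ((of F p).symm (((torsionLiftHom W hθ (kummerCocycle W u hup hu₀ σ)).val : (nilTheta F p hθ).toIdeal) : AinfTop F p)) ^ N =
      (p : bmaxZero F p) * zκ) :
    PadicLogSeries.logSum ((algebraMap (Ainf (p := p) F) (bmaxZero F p)).comp zpToAinf) (GaloisContinuity.formalLogNum W p) N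
        (algebraMap (Ainf (p := p) F) (bmaxZero F p)
          ((of F p).symm (((torsionLiftHom W hθ (kummerCocycle W u hup hu₀ σ)).val : (nilTheta F p hθ).toIdeal) : AinfTop F p))) zκ =
      galBmaxPlus σ (PadicLogSeries.logSum ((algebraMap (Ainf (p := p) F) (bmaxZero F p)).comp zpToAinf) (GaloisContinuity.formalLogNum W p) N
          (algebraMap (Ainf (p := p) F) (bmaxZero F p)
            ((of F p).symm (((divisionLiftPt W hθ u hup).val : (nilTheta F p hθ).toIdeal) : AinfTop F p))) z) -
        PadicLogSeries.logSum ((algebraMap (Ainf (p := p) F) (bmaxZero F p)).comp zpToAinf) (GaloisContinuity.formalLogNum W p) N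
          (algebraMap (Ainf (p := p) F) (bmaxZero F p)
            ((of F p).symm (((divisionLiftPt W hθ u hup).val : (nilTheta F p hθ).toIdeal) : AinfTop F p))) z := by
  haveI := isDomain_bmaxZero (F := F) (p := p)
  haveI := charZero_bmaxZero (F := F) (p := p)
  -- `[κσ~] + [ũ] = σ[ũ] = [σu~]`
  have hsum : torsionLiftHom W hθ (kummerCocycle W u hup hu₀ σ) + divisionLiftPt W hθ u hup =
      divisionLiftPt W hθ (galSeq F σ u) (mulPC_galSeq W hθ σ hup) := by
    rw [torsionLiftHom_kummerCocycle, sub_add_cancel, galPtN_divisionLiftPt]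
  -- nilpotence of the two points at index `N`
  have hκ := coe_val_pow_mem_of_thetaPt_eq_zero W _ (thetaPt_torsionLiftHom W (hθ := hθ) (kummerCocycle W u hup hu₀ σ)) hN
  have hU : (((divisionLiftPt W hθ u hup).val : (nilTheta F p hθ).toIdeal) : AinfTop F p) ^ N ∈ (WithIdeal.i : Ideal (AinfTop F p)) := by
    simpa only [one_nsmul] using pow_coe_val_nsmul_divisionLiftPt_mem W (hθ := hθ) hup huN 1
  -- witness for the sum: `σ z`
  have hzσ := algebraMap_divisionLiftPt_galSeq_pow_eq W hup (hθ := hθ) σ hz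
  rw [← hsum] at hzσ
  have hadd := logSum_val_add W _ _ hN hκ hU hzκ hz hzσ
  -- `Λ([σu~], σz) = σ Λ([ũ], z)`
  have hgal := galBmaxPlus_logSum_divisionLiftPt W (hθ := hθ) (GaloisContinuity.formalLogNum W p) σ hup N z
  rw [hsum] at hadd
  rw [← hgal] at hadd
  linear_combination -hadd

set_option maxHeartbeats 3200000 in
/-- ★★ **The φ-road's integrating pair.** With `Pω, Pη : T_pŴ →+ B_dR⁺` the honest maps of `exists_phiRoad_periodHoms` (recognised through `hLh`, `hPω`,
`hPη`), `u` as above, `Λ_u = Λ_N(ι[ũ], z)`, `b_ω := bmaxPlusToBdR Λ_u`, `b_η := bmaxPlusToBdR (φΛ_u)`: for every `σ ∈ Γ_F`,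
**`Pω(κ_u σ) = σ·b_ω − b_ω`** and **`Pη(κ_u σ) = σ·b_η − b_η`** (`bmaxPlusToBdR` is `Γ_F`-equivariant, `galBdRPlus_bmaxPlusToBdR`; `φσ = σφ`,
`galBmaxPlus_frobBmaxPlus`) — the hypotheses `hbω`, `hbη` of the socket's capstone. [cite: BlochKato1990, Ex. 3.10.1] [cite: Kato1993LNM1553, Ch. II Lemma 1.4.3] -/
theorem phiRoad_integrating_pair {N : ℕ} (hN : 1 ≤ N)
    (huN : ‖(((u 0 : (maxNilIdealC F).toIdeal) : CBall F) : CompletedAlgClosure F)‖ ^ N ≤ ‖(p : CompletedAlgClosure F)‖)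
    {z : bmaxZero F p}
    (hz : algebraMap (Ainf (p := p) F) (bmaxZero F p)
        ((of F p).symm (((divisionLiftPt W hθ u hup).val : (nilTheta F p hθ).toIdeal) : AinfTop F p)) ^ N = (p : bmaxZero F p) * z)
    {Lh : TatePt F p W →+ BmaxPlus F p} {Pω Pη : TatePt F p W →+ BdRPlusTop F p}
    (hLh : ∀ (τ : TatePt F p W) (z' : bmaxZero F p),
        algebraMap (Ainf (p := p) F) (bmaxZero F p)
            ((of F p).symm (((torsionLiftHom W hθ τ).val : (nilTheta F p hθ).toIdeal) : AinfTop F p)) ^ N = (p : bmaxZero F p) * z' →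
        Lh τ = PadicLogSeries.logSum ((algebraMap (Ainf (p := p) F) (bmaxZero F p)).comp zpToAinf) (GaloisContinuity.formalLogNum W p) N
          (algebraMap (Ainf (p := p) F) (bmaxZero F p)
            ((of F p).symm (((torsionLiftHom W hθ τ).val : (nilTheta F p hθ).toIdeal) : AinfTop F p))) z')
    (hPω : ∀ τ, Pω τ = BdRPlusTop.of F p (bmaxPlusToBdR F p (Lh τ)))
    (hPη : ∀ τ, Pη τ = BdRPlusTop.of F p (bmaxPlusToBdR F p (frobBmaxPlus F p (Lh τ)))) (σ : absoluteGaloisGroup F) :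
    Pω (kummerCocycle W u hup hu₀ σ) =
        BdRPlusTop.gal F p σ (BdRPlusTop.of F p (bmaxPlusToBdR F p
          (PadicLogSeries.logSum ((algebraMap (Ainf (p := p) F) (bmaxZero F p)).comp zpToAinf) (GaloisContinuity.formalLogNum W p) N
            (algebraMap (Ainf (p := p) F) (bmaxZero F p)
              ((of F p).symm (((divisionLiftPt W hθ u hup).val : (nilTheta F p hθ).toIdeal) : AinfTop F p))) z))) -
          BdRPlusTop.of F p (bmaxPlusToBdR F p
            (PadicLogSeries.logSum ((algebraMap (Ainf (p := p) F) (bmaxZero F p)).comp zpToAinf) (GaloisContinuity.formalLogNum W p) N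
              (algebraMap (Ainf (p := p) F) (bmaxZero F p)
                ((of F p).symm (((divisionLiftPt W hθ u hup).val : (nilTheta F p hθ).toIdeal) : AinfTop F p))) z)) ∧
      Pη (kummerCocycle W u hup hu₀ σ) =
        BdRPlusTop.gal F p σ (BdRPlusTop.of F p (bmaxPlusToBdR F p (frobBmaxPlus F p
          (PadicLogSeries.logSum ((algebraMap (Ainf (p := p) F) (bmaxZero F p)).comp zpToAinf) (GaloisContinuity.formalLogNum W p) N
            (algebraMap (Ainf (p := p) F) (bmaxZero F p)
              ((of F p).symm (((divisionLiftPt W hθ u hup).val : (nilTheta F p hθ).toIdeal) : AinfTop F p))) z)))) -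
          BdRPlusTop.of F p (bmaxPlusToBdR F p (frobBmaxPlus F p
            (PadicLogSeries.logSum ((algebraMap (Ainf (p := p) F) (bmaxZero F p)).comp zpToAinf) (GaloisContinuity.formalLogNum W p) N
              (algebraMap (Ainf (p := p) F) (bmaxZero F p)
                ((of F p).symm (((divisionLiftPt W hθ u hup).val : (nilTheta F p hθ).toIdeal) : AinfTop F p))) z))) := by
  obtain ⟨zκ, hzκ⟩ := exists_witness_of_thetaPt_eq_zero W _ (thetaPt_torsionLiftHom W (hθ := hθ) (kummerCocycle W u hup hu₀ σ)) hN
  have hK := logSum_torsionLiftHom_kummerCocycle W hup hu₀ hN huN hz σ hzκ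
  refine ⟨?_, ?_⟩
  · rw [hPω, hLh _ zκ hzκ, hK, map_sub, map_sub, BdRPlusTop.gal_of, galBdRPlus_bmaxPlusToBdR]
  · rw [hPη, hLh _ zκ hzκ, hK, map_sub, map_sub, map_sub, BdRPlusTop.gal_of, galBdRPlus_bmaxPlusToBdR, galBmaxPlus_frobBmaxPlus]

end AinfTop

end Literature.NumberTheory.PAdicHodge

end
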